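import Summits.AtomisticToContinuum.Crystallization.Theses.FrustrationRangeCertificates
import Summits.AtomisticToContinuum.Crystallization.Theses.PalmUnimodularRigidity
import Summits.AtomisticToContinuum.Crystallization.Theorems.FrustrationRangeCertificatesPatternPricedCertificatesSplit

/-! # STRATEGY-CENSUS sketch (strategist s1, crux `PatternPricedCertificates`, stmt-AtomisticToContinuum-12974)
Typed forms of the census entries (elaboration only; nothing here is an item). -/

namespace Summit.AtomisticToContinuum.Crystallization.Cruxes.PatternPricedCertificates.StrategistCensus

open Literature.MathematicalPhysics.StatisticalMechanics

/-- **S⁻ (Strengthen/Weaken entry): the weakest slice of the crux.** Already the instance `θ = 1`, `R → ∞` of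
`PatternPricedCertificates` contains: the relaxed hcp crystal ATTAINS the periodic minimum of the Lennard-Jones energy per particle
(`e(hcp_{a,h}) = e*`), i.e. the full 3-D Lennard-Jones lattice/periodic ground-state-energy problem (hcp vs fcc vs polytypes vs everything). -/
def HcpAttainsPeriodicMin : Prop :=
  ∃ (a h : ℝ) (ha : a ≠ 0) (hh : h ≠ 0),
    IsLeast (Set.range fun Q : PeriodicConfiguration 3 => Q.energyPerParticle lennardJones)
      ((hcpPeriodicConfiguration ha hh).energyPerParticle lennardJones)

/-- **S⁺ (Strengthen entry): θ-free, level-∞ PRICED Palm rigidity** — a first-order energy gap for minimising point-stationary laws in terms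
of the defect probability.  Stated with the route vocabulary of `PalmUnimodularRigidity` it is `PalmRigidity` plus a quantitative constant; it
CONTAINS `MinimiserShells` verbatim (take `R = 5/4`, bad = bad first shell) and so buys nothing for this step.  Recorded as a Prop schema over an
abstract defect functional to keep it def-light. -/
def PricedRigiditySchema (energyGap defect : (ℝ → ℝ) → ℝ) : Prop :=
  ∃ κ : ℝ, 0 < κ ∧ ∀ V : ℝ → ℝ, κ * defect V ≤ energyGap V

/-- The decomposition entry, by name (landed p171947): the crux from the two hub cruxes. -/
example : Theses.PalmUnimodularRigidity.MinimiserShells → Theses.PalmUnimodularRigidity.LayeredLawsSelectHcp →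
    Theses.FrustrationRangeCertificates.PatternPricedCertificates :=
  Theorems.PatternPricedCertificates.PatternPricedCertificates_of_subs

/-- The Transfer entry's sibling fact in the tree's language would be Hales' twelve-contact theorem (arXiv:1209.6043, Thm 1) — not in the
tree; its LJ analogue at measure level is exactly `MinimiserShells` → `ShellsToBarlowChart` (the latter CLOSED, stmt-9227). -/
example : Theses.PalmUnimodularRigidity.PalmRigidity → Theses.FrustrationRangeCertificates.PatternPricedCertificates :=
  Theorems.PatternPricedCertificates.patternPricedCertificates_of_palmRigidity_alone

end Summit.AtomisticToContinuum.Crystallization.Cruxes.PatternPricedCertificates.StrategistCensus
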